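import Mathlib
import Summits.NavierStokesRegularity.NavierStokesRegularity.Theorems.SubOnsagerCeilingKPStarvedNetworkStarvation
import HarnessLib

/-!
# STARVED NETWORKS WITH PUMP-FED BRANCHES — mechanism file (part 1 of 3 of the «branched» extension)
# (helper file for the crux `SubOnsagerCeiling.ForwardTailCeilingKP`, stmt-NavierStokesRegularity-27057, `--supports`)

The general starvation theorem `starvedNetwork_shellBarrierAt` (`Theorems/SubOnsagerCeilingKPStarvedNetwork*.lean`) asks that live
modes receive NO in-shell pumps (`P a e = 0` for `e ∉ Q`).  This extension relaxes that clause to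
«live modes outside a BRANCH SET `U` are unpumped, branch modes are unfed»: `P a e = 0` for `e ∉ Q ∪ U`, `w_{ce} = 0` for `e ∈ U` — so a
starved core may carry PUMP-FED SIDE BRANCHES `U` (live modes driven in-shell, like the side source of the witness `α_SB`, that feed or
pump onward into pockets or into other live modes), provided nobody feeds them forward.  Everything else is as in the general form: pockets `Q` forward-dead and pump-dead,
no differential triads, GRAM DOMINATION `r·Σ_{e∉Q} w_{ae}w_{ce} ≤ Σ_{d∈Q}(P a d·P c d + w_{ad}w_{cd})` for live `a, c`.
Why it still works: a pumped live mode never appears as an onward target in the domination function (its feed weights vanish), and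
live-to-live pumps are internal to the live block of a shell (they cancel in its energy balance).

* `starvedBr_quadTerm_unpumped` — closed form of an unpumped mode;
* `starvedBr_domination` — the Gram domination lemma for the branched class (one-sided Grönwall, as in the general form).

Sequels: `Theorems/SubOnsagerCeilingKPStarvedBranched{Flux,Barrier}.lean`.
HONEST FRAMING: statements about Tao-type MODEL lattice ODEs (route SubOnsagerCeiling, rung TL-M2Break); one architecture class; no stub,
crux or summit is proved and nothing here bears on Navier–Stokes regularity. [cite: Tao2016AveragedNS, §4 (4.2)–(4.3), (4.8), (4.13)]
[cite: Teschl2012, §2.4 (Grönwall)]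
-/

noncomputable section

-- the sub-problem namespace `NavierStokesRegularity.NavierStokesRegularity` is the tree's layout (D-0017)
set_option linter.dupNamespace false

namespace Summit.NavierStokesRegularity.NavierStokesRegularity.Theorems

open Set Finset MeasureTheory intervalIntegral
open scoped Topology
open Literature.Analysis.FluidPDE.TaoCascade

section StarvedBranched

variable {α : Fin 4 → Fin 4 → Fin 4 → ℤ × ℤ × ℤ → ℝ} {P : Fin 4 → Fin 4 → ℝ} {Q U : Finset (Fin 4)}
  (hs : IsSymmetricCoeff α) (hc : IsCancellingCoeff α)
  (hO : ∀ (Y : Fin 4 → ℤ → ℝ → ℝ) (τ : ℝ), (∀ (j : Fin 4) (k : ℤ), 1 ≤ k → 0 ≤ Y j k τ) →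
    ∀ δ : ℝ, 0 < δ → ∀ (i : Fin 4) (n : ℤ), 1 ≤ n → Y i n τ = 0 → 0 ≤ quadTerm δ α Y i n τ)
  (hD : ∀ a b i : Fin 4, a ≠ b → α a b i (0, 0, 1) = 0)
  (hPump : ∀ a d : Fin 4, α a a d (0, 0, 0) = P a d)
  (hCz : ∀ a b d : Fin 4, a ≠ b → a ≠ d → b ≠ d → α a b d (0, 0, 0) = 0)
  (hQw : ∀ d ∈ Q, ∀ e : Fin 4, α d d e (0, 0, 1) = 0)
  (hQP : ∀ d ∈ Q, ∀ j : Fin 4, P d j = 0)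
  (hU : ∀ j ∈ U, ∀ c : Fin 4, α c c j (0, 0, 1) = 0)
  (hPQ : ∀ a j : Fin 4, j ∉ Q → j ∉ U → P a j = 0)
include hs hc hO hD hPump hCz hQw hQP hU hPQ

omit hQw hQP hU hPQ in
/-- **An unpumped mode** `e` (`P a e = 0` for all `a`): `quadTerm_e(n) = Λ_{n-1}Σ_a w_{ae}x²_{a,n-1} − Λₙ x_{e,n}Σ_j w_{ej}x_{j,n+1} −
Λₙ x_{e,n}Σ_j P e j·x_{j,n}`. [cite: Tao2016AveragedNS, §4 (4.8)] -/
theorem starvedBr_quadTerm_unpumped (ε₀ : ℝ) (X : Fin 4 → ℤ → ℝ → ℝ) {e : Fin 4} (he : ∀ a : Fin 4, P a e = 0) (n : ℤ) (t : ℝ) :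
    quadTerm ε₀ α X e n t =
      (1 + ε₀) ^ ((5 : ℝ) * ((n : ℝ) - 1) / 2) * ∑ a, α a a e (0, 0, 1) * X a (n - 1) t ^ 2 -
        (1 + ε₀) ^ ((5 : ℝ) * n / 2) * (X e n t * ∑ j, α e e j (0, 0, 1) * X j (n + 1) t) -
        (1 + ε₀) ^ ((5 : ℝ) * n / 2) * (X e n t * ∑ j, P e j * X j n t) := by
  rw [starved_quadTerm hs hc hO hD hPump hCz]
  simp [he]
  ring

/-- **GRAM DOMINATION LEMMA, branched class** (live modes may be pumped in-shell provided they are not fed forward).  Along an honest non-negative `ν`-viscous solution from a one-shell datum (`ν ≥ 0`, `ε₀ ≥ 0`,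
`P ≥ 0`, `r ≥ 0`) of a starved network whose exits GRAM-DOMINATE its onward feeds,
`r·Σ_{e∉Q} w_{ae}w_{ce} ≤ Σ_{d∈Q} (P a d·P c d + w_{ad}w_{cd})` for all live `a, c`: for every live `a`, every shell `N ≥ 1` and
`t ∈ [0,s]`, `r·Σ_{e∉Q} w_{ae}·x_{e,N+1}(t) ≤ Σ_{d∈Q} P a d·x_{d,N}(t) + Σ_{d∈Q} w_{ad}·x_{d,N+1}(t)` (pump part and leak part
written separately).
(One-sided Grönwall on `e^{ν(1+ε₀)^{2(N+1)}t}·Z_a`, `Z_a = Σ_d (P a d·x_{d,N} + w_{ad}x_{d,N+1}) − rΣ_e w_{ae}x_{e,N+1}`: the pockets only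
accumulate, the live modes one shell up are driven by the same squares `x²_{c,N}` and otherwise only drain.)
[cite: Teschl2012, §2.4 (Grönwall)] -/
theorem starvedBr_domination {ε₀ ν s r : ℝ} (hε : 0 ≤ ε₀) (hν : 0 ≤ ν) (hr0 : 0 ≤ r) (hPnn : ∀ a d, 0 ≤ P a d)
    (hGram : ∀ a c : Fin 4, a ∉ Q → c ∉ Q →
      r * ∑ e ∈ Qᶜ, α a a e (0, 0, 1) * α c c e (0, 0, 1) ≤
        ∑ d ∈ Q, (P a d * P c d + α a a d (0, 0, 1) * α c c d (0, 0, 1)))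
    {X₀ : Fin 4 → ℝ} {X : Fin 4 → ℤ → ℝ → ℝ}
    (hdat : ∀ (i : Fin 4) (k : ℤ), X i k 0 = if k = 0 then X₀ i else 0)
    (hode : ∀ (i : Fin 4) (k : ℤ), ∀ t ∈ Icc (0 : ℝ) s, HasDerivWithinAt (X i k)
      (quadTerm ε₀ α X i k t - ν * (1 + ε₀) ^ ((2 : ℝ) * k) * X i k t) (Icc (0 : ℝ) s) t)
    (hnn : ∀ t ∈ Icc (0 : ℝ) s, ∀ (i : Fin 4) (k : ℤ), 1 ≤ k → 0 ≤ X i k t)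
    {a : Fin 4} (ha : a ∉ Q) {N : ℤ} (hN : 1 ≤ N) :
    ∀ t ∈ Icc (0 : ℝ) s, r * ∑ e ∈ Qᶜ, α a a e (0, 0, 1) * X e (N + 1) t ≤
      ∑ d ∈ Q, P a d * X d N t + ∑ d ∈ Q, α a a d (0, 0, 1) * X d (N + 1) t := by
  suffices hmain : ∀ t ∈ Icc (0 : ℝ) s, r * ∑ e ∈ Qᶜ, α a a e (0, 0, 1) * X e (N + 1) t ≤
      ∑ d ∈ Q, (P a d * X d N t + α a a d (0, 0, 1) * X d (N + 1) t) by
    intro t ht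
    rw [← Finset.sum_add_distrib]
    exact hmain t ht
  have hw0 : ∀ c i : Fin 4, 0 ≤ α c c i (0, 0, 1) := fun c i => kpProper_feed_nonneg hO c i
  set κ : ℝ := ν * (1 + ε₀) ^ ((2 : ℝ) * N) with hκ
  set κ' : ℝ := ν * (1 + ε₀) ^ ((2 : ℝ) * ((N + 1 : ℤ) : ℝ)) with hκ'
  have hb1 : (1 : ℝ) ≤ 1 + ε₀ := by linarith
  have hκκ' : κ ≤ κ' := by
    simp only [hκ, hκ']
    refine mul_le_mul_of_nonneg_left (Real.rpow_le_rpow_of_exponent_le hb1 ?_) hν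
    push_cast
    linarith
  have hκ'0 : 0 ≤ κ' := by positivity
  set u : ℝ → ℝ := fun τ => (∑ d ∈ Q, (P a d * X d N τ + α a a d (0, 0, 1) * X d (N + 1) τ)) -
    r * ∑ e ∈ Qᶜ, α a a e (0, 0, 1) * X e (N + 1) τ with hu
  set u' : ℝ → ℝ := fun τ =>
    (∑ d ∈ Q, (P a d * (quadTerm ε₀ α X d N τ - κ * X d N τ) +
      α a a d (0, 0, 1) * (quadTerm ε₀ α X d (N + 1) τ - κ' * X d (N + 1) τ))) -
    r * ∑ e ∈ Qᶜ, α a a e (0, 0, 1) * (quadTerm ε₀ α X e (N + 1) τ - κ' * X e (N + 1) τ) with hu'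
  have hud : ∀ τ ∈ Icc (0 : ℝ) s, HasDerivWithinAt u (u' τ) (Icc 0 s) τ := by
    intro τ hτ
    have h1 : ∀ d ∈ Q, HasDerivWithinAt (fun θ => P a d * X d N θ + α a a d (0, 0, 1) * X d (N + 1) θ)
        (P a d * (quadTerm ε₀ α X d N τ - κ * X d N τ) +
          α a a d (0, 0, 1) * (quadTerm ε₀ α X d (N + 1) τ - κ' * X d (N + 1) τ)) (Icc 0 s) τ :=
      fun d _ => ((hode d N τ hτ).const_mul _).add ((hode d (N + 1) τ hτ).const_mul _)
    have h2 : ∀ e ∈ Qᶜ, HasDerivWithinAt (fun θ => α a a e (0, 0, 1) * X e (N + 1) θ)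
        (α a a e (0, 0, 1) * (quadTerm ε₀ α X e (N + 1) τ - κ' * X e (N + 1) τ)) (Icc 0 s) τ :=
      fun e _ => (hode e (N + 1) τ hτ).const_mul _
    exact (HasDerivWithinAt.fun_sum h1).sub ((HasDerivWithinAt.fun_sum h2).const_mul r)
  have hkey : ∀ τ ∈ Icc (0 : ℝ) s, 0 ≤ u' τ + κ' * u τ := by
    intro τ hτ
    have hΛ : 0 ≤ (1 + ε₀) ^ ((5 : ℝ) * N / 2) := Real.rpow_nonneg (by linarith) _
    have hΛm : 0 ≤ (1 + ε₀) ^ ((5 : ℝ) * ((N : ℝ) - 1) / 2) := Real.rpow_nonneg (by linarith) _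
    have hΛ' : 0 ≤ (1 + ε₀) ^ ((5 : ℝ) * ((N + 1 : ℤ) : ℝ) / 2) := Real.rpow_nonneg (by linarith) _
    have hxN : ∀ i, 0 ≤ X i N τ := fun i => hnn τ hτ i _ (by omega)
    have hxN1 : ∀ i, 0 ≤ X i (N + 1) τ := fun i => hnn τ hτ i _ (by omega)
    have hxN2 : ∀ i, 0 ≤ X i (N + 1 + 1) τ := fun i => hnn τ hτ i _ (by omega)
    have hidx : (N + 1 - 1 : ℤ) = N := by omega
    have hexp : ((5 : ℝ) * ((((N + 1 : ℤ)) : ℝ) - 1) / 2) = (5 : ℝ) * N / 2 := by push_cast; ring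
    -- the common driver `Σ_c x²_{c,N}`-forms
    set SP : Fin 4 → ℝ := fun d => ∑ c, P c d * X c N τ ^ 2 with hSP
    set SW : Fin 4 → ℝ := fun i => ∑ c, α c c i (0, 0, 1) * X c N τ ^ 2 with hSW
    -- (i) a pocket at shell `N` gains at least its pumps
    have hpocketN : ∀ d ∈ Q, (1 + ε₀) ^ ((5 : ℝ) * N / 2) * SP d ≤ quadTerm ε₀ α X d N τ := by
      intro d hd
      rw [starved_quadTerm_pocket hs hc hO hD hPump hCz hQw hQP ε₀ X hd]
      have : 0 ≤ (1 + ε₀) ^ ((5 : ℝ) * ((N : ℝ) - 1) / 2) * ∑ c, α c c d (0, 0, 1) * X c (N - 1) τ ^ 2 :=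
        mul_nonneg hΛm (Finset.sum_nonneg fun c _ => mul_nonneg (hw0 c d) (sq_nonneg _))
      linarith
    -- (ii) a pocket at shell `N+1` gains at least its leaks
    have hpocketN1 : ∀ d ∈ Q, (1 + ε₀) ^ ((5 : ℝ) * N / 2) * SW d ≤ quadTerm ε₀ α X d (N + 1) τ := by
      intro d hd
      rw [starved_quadTerm_pocket hs hc hO hD hPump hCz hQw hQP ε₀ X hd, hidx, hexp]
      have : 0 ≤ (1 + ε₀) ^ ((5 : ℝ) * ((N + 1 : ℤ) : ℝ) / 2) * ∑ c, P c d * X c (N + 1) τ ^ 2 :=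
        mul_nonneg hΛ' (Finset.sum_nonneg fun c _ => mul_nonneg (hPnn c d) (sq_nonneg _))
      linarith
    -- (iii) a FED live mode at shell `N+1` is unpumped, so gains at most its feeds (unfed ones carry the factor `w_{ae} = 0`)
    have hliveN1 : ∀ e ∈ Qᶜ, α a a e (0, 0, 1) * quadTerm ε₀ α X e (N + 1) τ ≤
        α a a e (0, 0, 1) * ((1 + ε₀) ^ ((5 : ℝ) * N / 2) * SW e) := by
      intro e he
      rw [Finset.mem_compl] at he
      by_cases hw : α a a e (0, 0, 1) = 0
      · rw [hw, zero_mul, zero_mul]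
      have hunp : ∀ c, P c e = 0 := by
        intro c
        by_cases heU : e ∈ U
        · exact absurd (hU e heU a) hw
        · exact hPQ c e he heU
      refine mul_le_mul_of_nonneg_left ?_ (hw0 a e)
      rw [starvedBr_quadTerm_unpumped hs hc hO hD hPump hCz ε₀ X hunp, hidx, hexp]
      have h1 : 0 ≤ (1 + ε₀) ^ ((5 : ℝ) * ((N + 1 : ℤ) : ℝ) / 2) *
          (X e (N + 1) τ * ∑ j, α e e j (0, 0, 1) * X j (N + 1 + 1) τ) :=
        mul_nonneg hΛ' (mul_nonneg (hxN1 e) (Finset.sum_nonneg fun j _ => mul_nonneg (hw0 e j) (hxN2 j)))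
      have h2 : 0 ≤ (1 + ε₀) ^ ((5 : ℝ) * ((N + 1 : ℤ) : ℝ) / 2) *
          (X e (N + 1) τ * ∑ j, P e j * X j (N + 1) τ) :=
        mul_nonneg hΛ' (mul_nonneg (hxN1 e) (Finset.sum_nonneg fun j _ => mul_nonneg (hPnn e j) (hxN1 j)))
      linarith
    -- the Gram bracket, mode by mode
    have hbracket : ∀ c : Fin 4, 0 ≤ ((∑ d ∈ Q, P a d * P c d) + (∑ d ∈ Q, α a a d (0, 0, 1) * α c c d (0, 0, 1)) -
        r * ∑ e ∈ Qᶜ, α a a e (0, 0, 1) * α c c e (0, 0, 1)) * X c N τ ^ 2 := by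
      intro c
      refine mul_nonneg ?_ (sq_nonneg _)
      by_cases hcQ : c ∈ Q
      · have h1 : ∑ d ∈ Q, P a d * P c d = 0 :=
          Finset.sum_eq_zero fun d _ => by rw [hQP c hcQ d]; ring
        have h1' : ∑ d ∈ Q, α a a d (0, 0, 1) * α c c d (0, 0, 1) = 0 :=
          Finset.sum_eq_zero fun d _ => by rw [hQw c hcQ d]; ring
        have h2 : ∑ e ∈ Qᶜ, α a a e (0, 0, 1) * α c c e (0, 0, 1) = 0 :=
          Finset.sum_eq_zero fun e _ => by rw [hQw c hcQ e]; ring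
        rw [h1, h1', h2]
        simp
      · have h := hGram a c ha hcQ
        rw [Finset.sum_add_distrib] at h
        linarith
    -- exchanging the sums
    have e1 : ∑ d ∈ Q, P a d * SP d = ∑ c, (∑ d ∈ Q, P a d * P c d) * X c N τ ^ 2 := by
      simp only [hSP, Finset.mul_sum, Finset.sum_mul]
      rw [Finset.sum_comm]
      exact Finset.sum_congr rfl fun c _ => Finset.sum_congr rfl fun d _ => by ring
    have e2 : ∑ d ∈ Q, α a a d (0, 0, 1) * SW d = ∑ c, (∑ d ∈ Q, α a a d (0, 0, 1) * α c c d (0, 0, 1)) * X c N τ ^ 2 := by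
      simp only [hSW, Finset.mul_sum, Finset.sum_mul]
      rw [Finset.sum_comm]
      exact Finset.sum_congr rfl fun c _ => Finset.sum_congr rfl fun d _ => by ring
    have e3 : ∑ e ∈ Qᶜ, α a a e (0, 0, 1) * SW e = ∑ c, (∑ e ∈ Qᶜ, α a a e (0, 0, 1) * α c c e (0, 0, 1)) * X c N τ ^ 2 := by
      simp only [hSW, Finset.mul_sum, Finset.sum_mul]
      rw [Finset.sum_comm]
      exact Finset.sum_congr rfl fun c _ => Finset.sum_congr rfl fun d _ => by ring
    have hexch : (∑ d ∈ Q, (P a d * SP d + α a a d (0, 0, 1) * SW d)) - r * ∑ e ∈ Qᶜ, α a a e (0, 0, 1) * SW e =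
        ∑ c, ((∑ d ∈ Q, P a d * P c d) + (∑ d ∈ Q, α a a d (0, 0, 1) * α c c d (0, 0, 1)) -
          r * ∑ e ∈ Qᶜ, α a a e (0, 0, 1) * α c c e (0, 0, 1)) * X c N τ ^ 2 := by
      rw [Finset.sum_add_distrib, e1, e2, e3, Finset.mul_sum, ← Finset.sum_add_distrib, ← Finset.sum_sub_distrib]
      exact Finset.sum_congr rfl fun c _ => by ring
    have hsum0 : 0 ≤ (∑ d ∈ Q, (P a d * SP d + α a a d (0, 0, 1) * SW d)) -
        r * ∑ e ∈ Qᶜ, α a a e (0, 0, 1) * SW e := by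
      rw [hexch]
      exact Finset.sum_nonneg fun c _ => hbracket c
    -- assembling `u' + κ' u`
    have hsimp : u' τ + κ' * u τ =
        (∑ d ∈ Q, (P a d * (quadTerm ε₀ α X d N τ + (κ' - κ) * X d N τ) +
          α a a d (0, 0, 1) * quadTerm ε₀ α X d (N + 1) τ)) -
        r * ∑ e ∈ Qᶜ, α a a e (0, 0, 1) * quadTerm ε₀ α X e (N + 1) τ := by
      simp only [hu, hu', Finset.mul_sum, mul_sub, Finset.sum_sub_distrib, Finset.sum_add_distrib, mul_add]
      have e1 : ∑ d ∈ Q, P a d * ((κ' - κ) * X d N τ) = ∑ d ∈ Q, κ' * (P a d * X d N τ) - ∑ d ∈ Q, P a d * (κ * X d N τ) := by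
        rw [← Finset.sum_sub_distrib]
        exact Finset.sum_congr rfl fun d _ => by ring
      have e2 : ∑ d ∈ Q, α a a d (0, 0, 1) * (κ' * X d (N + 1) τ) = ∑ d ∈ Q, κ' * (α a a d (0, 0, 1) * X d (N + 1) τ) :=
        Finset.sum_congr rfl fun d _ => by ring
      have e3 : ∑ e ∈ Qᶜ, r * (α a a e (0, 0, 1) * (κ' * X e (N + 1) τ)) =
          κ' * ∑ e ∈ Qᶜ, r * (α a a e (0, 0, 1) * X e (N + 1) τ) := by
        rw [Finset.mul_sum]
        exact Finset.sum_congr rfl fun e _ => by ring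
      rw [e1, e2, e3, Finset.mul_sum]
      ring
    rw [hsimp]
    -- lower bounds term by term
    have hL1 : ∑ d ∈ Q, (P a d * ((1 + ε₀) ^ ((5 : ℝ) * N / 2) * SP d) + α a a d (0, 0, 1) * ((1 + ε₀) ^ ((5 : ℝ) * N / 2) * SW d)) ≤
        ∑ d ∈ Q, (P a d * (quadTerm ε₀ α X d N τ + (κ' - κ) * X d N τ) + α a a d (0, 0, 1) * quadTerm ε₀ α X d (N + 1) τ) := by
      refine Finset.sum_le_sum fun d hd => add_le_add ?_ ?_
      · have h3 : 0 ≤ (κ' - κ) * X d N τ := mul_nonneg (by linarith) (hxN d)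
        exact mul_le_mul_of_nonneg_left (by linarith [hpocketN d hd]) (hPnn a d)
      · exact mul_le_mul_of_nonneg_left (hpocketN1 d hd) (hw0 a d)
    have hL2 : r * ∑ e ∈ Qᶜ, α a a e (0, 0, 1) * quadTerm ε₀ α X e (N + 1) τ ≤
        r * ∑ e ∈ Qᶜ, α a a e (0, 0, 1) * ((1 + ε₀) ^ ((5 : ℝ) * N / 2) * SW e) :=
      mul_le_mul_of_nonneg_left (Finset.sum_le_sum fun e he => hliveN1 e he) hr0
    have hL3 : (∑ d ∈ Q, (P a d * ((1 + ε₀) ^ ((5 : ℝ) * N / 2) * SP d) + α a a d (0, 0, 1) * ((1 + ε₀) ^ ((5 : ℝ) * N / 2) * SW d))) -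
        r * ∑ e ∈ Qᶜ, α a a e (0, 0, 1) * ((1 + ε₀) ^ ((5 : ℝ) * N / 2) * SW e) =
        (1 + ε₀) ^ ((5 : ℝ) * N / 2) *
          ((∑ d ∈ Q, (P a d * SP d + α a a d (0, 0, 1) * SW d)) - r * ∑ e ∈ Qᶜ, α a a e (0, 0, 1) * SW e) := by
      rw [mul_sub, Finset.mul_sum, Finset.mul_sum, Finset.mul_sum, Finset.mul_sum]
      congr 1
      · exact Finset.sum_congr rfl fun d _ => by ring
      · exact Finset.sum_congr rfl fun e _ => by ring
    have hL4 : 0 ≤ (1 + ε₀) ^ ((5 : ℝ) * N / 2) *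
        ((∑ d ∈ Q, (P a d * SP d + α a a d (0, 0, 1) * SW d)) - r * ∑ e ∈ Qᶜ, α a a e (0, 0, 1) * SW e) :=
      mul_nonneg hΛ hsum0
    linarith
  set G : ℝ → ℝ := fun τ => Real.exp (κ' * τ) * u τ with hG
  set G' : ℝ → ℝ := fun τ => Real.exp (κ' * τ) * (u' τ + κ' * u τ) with hG'
  have hGd : ∀ τ ∈ Icc (0 : ℝ) s, HasDerivWithinAt G (G' τ) (Icc 0 s) τ := by
    intro τ hτ
    have hexp : HasDerivWithinAt (fun θ => Real.exp (κ' * θ)) (Real.exp (κ' * τ) * κ') (Icc 0 s) τ := by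
      have := ((hasDerivAt_id τ).const_mul κ').exp
      simpa using this.hasDerivWithinAt
    have h := hexp.mul (hud τ hτ)
    refine h.congr_deriv ?_
    simp only [hG']
    ring
  have hGmono : MonotoneOn G (Icc 0 s) := by
    have hGcont : ContinuousOn G (Icc 0 s) := fun τ hτ => (hGd τ hτ).continuousWithinAt
    refine monotoneOn_of_hasDerivWithinAt_nonneg (f' := G') (convex_Icc 0 s) hGcont ?_ ?_
    · intro x hx
      rw [interior_Icc] at hx ⊢
      exact (hGd x (Ioo_subset_Icc_self hx)).mono Ioo_subset_Icc_self
    · intro x hx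
      rw [interior_Icc] at hx
      exact mul_nonneg (Real.exp_pos _).le (hkey x (Ioo_subset_Icc_self hx))
  have hG0 : G 0 = 0 := by
    have h1 : ∀ i, X i N 0 = 0 := fun i => by rw [hdat]; simp; omega
    have h2 : ∀ i, X i (N + 1) 0 = 0 := fun i => by rw [hdat]; simp; omega
    simp [hG, hu, h1, h2]
  intro t ht
  have hGt : 0 ≤ G t := by
    rw [← hG0]
    exact hGmono ⟨le_rfl, ht.1.trans ht.2⟩ ht ht.1
  have hexp : 0 < Real.exp (κ' * t) := Real.exp_pos _
  have hut : 0 ≤ u t := by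
    by_contra hh
    push Not at hh
    have : G t < 0 := by simp only [hG]; nlinarith [mul_pos hexp (neg_pos.2 hh)]
    linarith
  simp only [hu] at hut
  linarith

end StarvedBranched

end Summit.NavierStokesRegularity.NavierStokesRegularity.Theorems

end
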